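import Literature.NumberTheory.IwasawaTheory.ClassNumberPExpSuccEqOfCardFixedLeTrivialBase
import Literature.NumberTheory.IwasawaTheory.Fukuda1994Thm1RankProofs
import Literature.NumberTheory.IwasawaTheory.ClassicalLambdaLeStableRank
import HarnessLib

/-!
# The RANK door over a base with `p ∤ h_K`: coinvariants of `Cl(K_{n+1})/p` of `p`-rank `≤ rank_p Cl(K_n)` force
# `rank_p Cl(K_{n+1}) = rank_p Cl(K_n)`, hence constant ranks, `μ = 0`, `λ ≤ rank_p Cl(K_n)` (every prime; proved, no definition, no named fact)

Topic `NumberTheory/IwasawaTheory` (namespace = path).  THEOREMS ONLY.  Companion of `ClassNumberPExpSuccEqOfCardFixedLeTrivialBase.lean`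
(this seat: the ORDER door `#Cl(K_{n+1})^G ≤ h(K_n)` ⟹ `e_{n+1} = e_n` over a base with `p ∤ h_K`).  The same `ν`-element argument gives a
door on `p`-RANKS whose input is the `p`-rank of the GENUS quotient `Cl(K_{n+1})/(Cl^p·⟨τc/c⟩)` (coinvariants of `Cl(K_{n+1})/p`), in the
currency of the tree's coinvariant criterion (`ClassGroupPRankCoinvariantCriterion`, door L12: coinvariant rank `≤ c < p^i`; at `p = 2`, `i = 1`
only `c ≤ 1`).  With `p ∤ h_K` ANY coinvariant rank is allowed provided it does not exceed `rank_p Cl(K_n)`: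

**Theorem** (`classGroupPRank_layer_succ_eq_of_coinvariant_index_le`).  `κ` a `ℤ_p`-extension of `K` with `p ∤ h_K`; `M = K_n ⊆ L = K_{n+1}`
(any compatible algebra structure), `N_{L/M}` onto, `[Cl(L) : Cl(L)^p·⟨τc/c : τ ∈ Gal(L/M)⟩] ≤ #(Cl(M)/Cl(M)^p)`.  Then
`rank_p Cl(L) = rank_p Cl(M)`; so (Fukuda Thm 1 (2), tree theorem) the `p`-ranks are constant from `K_n` on, `μ = 0`, `λ ≤ rank_p Cl(K_n)`
(`classGroupPRank_const_and_classicalMuVanishes_of_coinvariant_index_le`).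

PROOF.  `E := N⁻¹(Cl(M)^p) ⊇ D := Cl(L)^p·⟨τc/c⟩` and `N` onto give `[Cl(L) : E] = #(Cl(M)/Cl(M)^p)`, so `D = E`.  With `γ` a topological
generator, `g = γ|_L`, `σ = γ^{pⁿ}|_L`, `ν = Σ_{i<pⁿ} g^i`: (i) `ν·Cl(L) ⊆ E` — `N(νc) = i_{M/K}(N_{M/K} N c)` (equivariance, Neukirch (1.6)(iv))
and every class of `K` is a `p`-th power as `p ∤ h_K` (`classGroupNorm_prod_galois_pow_smul_mem_range_powMonoidHom`); (ii) `σc/c = g(νc)/νc`;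
so every element of `E = D` is `g(e')e'⁻¹·q` (`e' ∈ E`, `q ∈ Cl^p`), and `g − 1` is nilpotent on the elementary abelian `Cl(L)/Cl(L)^p`
(`FukudaNakayama.sub_one_pow_prime_pow_apply_eq_zero_of_smul_eq_zero`), whence `E = Cl(L)^p` and `Cl(L)/Cl(L)^p ≅ Cl(M)/Cl(M)^p`.
The hypothesis is implied by Fukuda's `rank_p Cl(L) = rank_p Cl(M)` (the genus quotient sits between `Cl(M)/p` and `Cl(L)/p`) and is decided by
genus theory in `M` (a ray class group of `M` modulo local norms), not by `Cl(L)`.  USE (cell bsd-f1-sign2, crux C2): on the split stratum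
`Δ_W ≡ 1 (8)` (no order door fires there, Summits `…SplitStratumUnitIndexBound`) this is the door; with `h(ℚ(β))` odd its input at `(F_1, F_2)` is the
`2`-rank of the genus group of `F_2/F_1`, a datum of the SEXTIC `F_1`.  HONEST SCOPE: classical; nothing summit-specific; BSD is not advanced.

## References

* L. C. Washington, *Introduction to Cyclotomic Fields*, 2nd ed., GTM 83 (1997), §13.3 Lemmas 13.15–13.18, Prop. 13.22–13.23. [Washington1997]
* T. Fukuda, *Remarks on `ℤ_p`-extensions of number fields*, Proc. Japan Acad. 70 A (1994), Thm. 1 (2), p. 264. [Fukuda1994]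
* J. Neukirch, *Algebraic Number Theory* (1999), Ch. III §1 Prop. (1.6) (iv). [NeukirchANT1999]
-/

noncomputable section

open NumberField IsDedekindDomain Field Finset
open scoped nonZeroDivisors

namespace Literature.NumberTheory.IwasawaTheory

open Literature.NumberTheory.EllipticCurves Literature.NumberTheory.NumberFields
  Literature.NumberTheory.GaloisRepresentations

/-! ## §0 Algebra -/

section Algebra

/-- A finite commutative group of exponent `p` has order `p ^ (ord_p of its order)`. [folklore] -/
private theorem card_eq_pow_padicValNat_of_pow_eq_one {G : Type*} [CommGroup G] [Finite G] {p : ℕ} [hp : Fact p.Prime]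
    (h : ∀ g : G, g ^ p = 1) : Nat.card G = p ^ padicValNat p (Nat.card G) := by
  have hG : IsPGroup p G := fun g => ⟨1, by rw [pow_one]; exact h g⟩
  obtain ⟨k, hk⟩ := hG.exists_card_eq
  rw [hk, padicValNat.prime_pow]

/-- In a group of order prime to `p` every element is a `p`-th power. [folklore] -/
private theorem exists_pow_eq_of_coprime_card {G : Type*} [CommGroup G] [Fintype G] {p : ℕ}
    (h : Nat.Coprime (Fintype.card G) p) (g : G) : ∃ g' : G, g' ^ p = g := by
  obtain ⟨u, hu⟩ : ∃ u : ℕ, g ^ (p * u) = g := by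
    rcases Nat.lt_or_ge 1 (Fintype.card G) with h1 | h1
    · obtain ⟨u, -, hu⟩ := Nat.exists_mul_mod_eq_one_of_coprime h.symm h1
      refine ⟨u, ?_⟩
      rw [← pow_mod_card, hu, pow_one]
    · refine ⟨0, ?_⟩
      haveI : Subsingleton G := Fintype.card_le_one_iff_subsingleton.mp h1
      exact Subsingleton.elim _ _
  exact ⟨g ^ u, by rw [← pow_mul, mul_comm, hu]⟩

/-- **A `(g − 1)`-divisible subgroup modulo `p`-th powers is trivial.**  `A` finite commutative, `P = A^p`, `g^{p^k} = 1` on `A`, `E ⊇ P` with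
every `e ∈ E` of the form `g(e')·e'⁻¹·q` (`e' ∈ E`, `q ∈ P`) ⟹ `E = P` (`Ē ⊆ (g−1)Ē` in `A/P`, where `(g − 1)^{p^k} = 0`,
tree `FukudaNakayama.sub_one_pow_prime_pow_apply_eq_zero_of_smul_eq_zero`). [cite: Washington1997, §13.3 Lemma 13.16 (proof)] -/
private theorem eq_range_powMonoidHom_of_divisible {A : Type*} [CommGroup A] [Finite A] {p : ℕ} [hp : Fact p.Prime] (k : ℕ)
    (g : MulAut A) (hg : ∀ a : A, (g ^ (p ^ k)) a = a) (E : Subgroup A)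
    (hPE : (powMonoidHom p : A →* A).range ≤ E)
    (hE : ∀ e ∈ E, ∃ e' ∈ E, ∃ q ∈ (powMonoidHom p : A →* A).range, e = g e' * e'⁻¹ * q) :
    E = (powMonoidHom p : A →* A).range := by
  classical
  refine le_antisymm ?_ hPE
  set P := (powMonoidHom p : A →* A).range with hP
  let T : A →* A :=
    { toFun := fun c => g c * c⁻¹
      map_one' := by rw [map_one, inv_one, mul_one]
      map_mul' := fun a b => by rw [map_mul, mul_inv, mul_mul_mul_comm] }
  have hT : ∀ c, T c = g c * c⁻¹ := fun _ => rfl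
  have hTP : P ≤ P.comap T := by
    rintro _ ⟨c, rfl⟩
    rw [Subgroup.mem_comap, powMonoidHom_apply, map_pow]
    exact MonoidHom.mem_range.mpr ⟨T c, rfl⟩
  have hgP : P ≤ P.comap g.toMonoidHom := by
    rintro _ ⟨c, rfl⟩
    rw [Subgroup.mem_comap, powMonoidHom_apply, MulEquiv.coe_toMonoidHom, map_pow]
    exact MonoidHom.mem_range.mpr ⟨g c, rfl⟩
  let Tb : A ⧸ P →* A ⧸ P := QuotientGroup.map P P T hTP
  let Gb : A ⧸ P →* A ⧸ P := QuotientGroup.map P P g.toMonoidHom hgP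
  have hTb_mk : ∀ c : A, Tb (c : A ⧸ P) = ((T c : A) : A ⧸ P) := fun c => QuotientGroup.map_mk P P T hTP c
  have hGb_mk : ∀ c : A, Gb (c : A ⧸ P) = ((g c : A) : A ⧸ P) := fun c => QuotientGroup.map_mk P P g.toMonoidHom hgP c
  set Eb : Subgroup (A ⧸ P) := E.map (QuotientGroup.mk' P) with hEb
  have hgen : ∀ x ∈ Eb, ∃ y ∈ Eb, x = Tb y := by
    rintro _ ⟨e, he, rfl⟩
    obtain ⟨e', he', q, hq, heq⟩ := hE e he
    refine ⟨QuotientGroup.mk' P e', Subgroup.mem_map_of_mem _ he', ?_⟩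
    rw [QuotientGroup.mk'_apply, QuotientGroup.mk'_apply, hTb_mk, hT, heq, eq_comm, QuotientGroup.eq, inv_mul_cancel_left]
    exact hq
  have hiter : ∀ (r : ℕ), ∀ x ∈ Eb, ∃ y ∈ Eb, x = Tb^[r] y := by
    intro r
    induction r with
    | zero => exact fun x hx => ⟨x, hx, rfl⟩
    | succ r ih =>
      intro x hx
      obtain ⟨y, hy, rfl⟩ := ih x hx
      obtain ⟨z, hz, rfl⟩ := hgen y hy
      exact ⟨z, hz, (Function.iterate_succ_apply Tb r z).symm⟩
  have hnil : ∀ v : A ⧸ P, Tb^[p ^ k] v = 1 := by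
    intro v
    let φ : Module.End ℤ (Additive (A ⧸ P)) := (MonoidHom.toAdditive Gb).toIntLinearMap
    have hφapp : ∀ y, φ (Additive.ofMul y) = Additive.ofMul (Gb y) := fun y => rfl
    have hTφ : ∀ y, Additive.ofMul (Tb y) = (φ - 1) (Additive.ofMul y) := by
      intro y
      induction y using QuotientGroup.induction_on with
      | H c =>
        rw [hTb_mk, LinearMap.sub_apply, hφapp, hGb_mk, Module.End.one_apply, ← ofMul_div, hT, div_eq_mul_inv,
          QuotientGroup.mk_mul, QuotientGroup.mk_inv]
    have hTφit : ∀ (r : ℕ) (y), Additive.ofMul (Tb^[r] y) = ((φ - 1) ^ r) (Additive.ofMul y) := by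
      intro r
      induction r with
      | zero => intro y; rw [Function.iterate_zero, id, pow_zero, Module.End.one_apply]
      | succ r ih => intro y; rw [Function.iterate_succ_apply', hTφ, ih, pow_succ', Module.End.mul_apply]
    have hGpow_mk : ∀ (i : ℕ) (c : A), Gb^[i] (c : A ⧸ P) = (((g ^ i) c : A) : A ⧸ P) := by
      intro i
      induction i with
      | zero => intro c; rw [Function.iterate_zero, id, pow_zero, MulAut.one_apply]
      | succ i ih => intro c; rw [Function.iterate_succ_apply', ih, hGb_mk, pow_succ', MulAut.mul_apply]
    have hφpow : ∀ (i : ℕ) (y), (φ ^ i) (Additive.ofMul y) = Additive.ofMul (Gb^[i] y) := by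
      intro i
      induction i with
      | zero => intro y; rw [pow_zero, Module.End.one_apply, Function.iterate_zero, id]
      | succ i ih => intro y; rw [pow_succ', Module.End.mul_apply, ih, hφapp, Function.iterate_succ_apply']
    have hφk : φ ^ (p ^ k) = 1 := by
      refine LinearMap.ext fun w => ?_
      induction w using QuotientGroup.induction_on with
      | H c =>
        change (φ ^ (p ^ k)) (Additive.ofMul (c : A ⧸ P)) = Additive.ofMul (c : A ⧸ P)
        rw [hφpow, hGpow_mk, hg]
    have hv : (p : ℤ) • Additive.ofMul v = 0 := by
      rw [natCast_zsmul, ← ofMul_pow]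
      induction v using QuotientGroup.induction_on with
      | H c =>
        rw [← ofMul_one]
        exact congrArg Additive.ofMul ((QuotientGroup.eq_one_iff (c ^ p)).mpr (MonoidHom.mem_range.mpr ⟨c, rfl⟩))
    have key := FukudaNakayama.sub_one_pow_prime_pow_apply_eq_zero_of_smul_eq_zero p k φ hφk hv
    rw [← hTφit] at key
    exact Additive.ofMul.injective key
  intro x hx
  have hx' : QuotientGroup.mk' P x ∈ Eb := Subgroup.mem_map_of_mem _ hx
  obtain ⟨y, -, hy⟩ := hiter (p ^ k) _ hx'
  rw [hnil y, QuotientGroup.mk'_apply, QuotientGroup.eq_one_iff] at hy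
  exact hy

end Algebra

/-! ## §1 Two consecutive layers `K_n ⊆ K_{n+1}` -/

section Layer

variable {K : Type} [Field K] [NumberField K] {p : ℕ} [hp : Fact p.Prime] (κ : ZpExtension K p) (n : ℕ)
  [Algebra (κ.layer n) (κ.layer (n + 1))] [IsScalarTower K (κ.layer n) (κ.layer (n + 1))]

/-- **The `ν`-element of ANY class lands in `N⁻¹(Cl(K_n)^p)`** (`p ∤ h_K`): `N(∏_{i<pⁿ} γ^i|_{K_{n+1}} • c) = i(N_{K_n/K} N c)` (equivariance,
Neukirch (1.6)(iv)) is a `p`-th power, every class of `K` being one. [cite: Washington1997, §13.3 Prop. 13.22 (proof)]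
[cite: NeukirchANT1999, Ch. III §1 Prop. (1.6) (iv)] -/
theorem classGroupNorm_prod_galois_pow_smul_mem_range_powMonoidHom [NumberField (κ.layer n)] [NumberField (κ.layer (n + 1))]
    [Normal K (κ.layer n)] [Normal K (κ.layer (n + 1))] (hK : ¬ p ∣ classNumber K) {γ : absoluteGaloisGroup K}
    (hγ : κ.IsTopGenerator γ) (c : ClassGroup (𝓞 (κ.layer (n + 1)))) :
    classGroupNorm (κ.layer n) (κ.layer (n + 1))
      (∏ i ∈ range (p ^ n),
        ClassGroup.mulEquiv (AmbiguousClass.intAut (absRestrictNormalHom (κ.layer (n + 1)) γ ^ i)) c) ∈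
      (powMonoidHom p : ClassGroup (𝓞 (κ.layer n)) →* ClassGroup (𝓞 (κ.layer n))).range := by
  classical
  haveI : FiniteDimensional K (κ.layer n) := κ.finiteDimensional_layer_holds n
  haveI : FiniteDimensional K (κ.layer (n + 1)) := κ.finiteDimensional_layer_holds (n + 1)
  haveI : IsGalois K (κ.layer n) := κ.isGalois_layer_holds n
  haveI : IsGalois K (κ.layer (n + 1)) := κ.isGalois_layer_holds (n + 1)
  rw [map_prod]
  have heq : ∀ i : ℕ, classGroupNorm (κ.layer n) (κ.layer (n + 1))
      (ClassGroup.mulEquiv (AmbiguousClass.intAut (absRestrictNormalHom (κ.layer (n + 1)) γ ^ i)) c) =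
      ClassGroup.mulEquiv (AmbiguousClass.intAut (absRestrictNormalHom (κ.layer n) γ ^ i))
        (classGroupNorm (κ.layer n) (κ.layer (n + 1)) c) := fun i => by
    rw [← map_pow, ← map_pow]
    exact classGroupNorm_layer_layer_mulEquiv_intAut_absRestrictNormalHom κ (γ ^ i) c
  simp_rw [heq]
  set y := classGroupNorm (κ.layer n) (κ.layer (n + 1)) c with hy
  have hord : orderOf (absRestrictNormalHom (κ.layer n) γ) = p ^ n := orderOf_absRestrictNormalHom_layer κ hγ n
  have hgen : Subgroup.zpowers (absRestrictNormalHom (κ.layer n) γ) = ⊤ := zpowers_absRestrictNormalHom_layer_eq_top κ hγ n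
  have hcardG : Nat.card ((κ.layer n) ≃ₐ[K] (κ.layer n)) = p ^ n := by
    rw [IsGalois.card_aut_eq_finrank, κ.finrank_layer_holds n]
  have hinj : Function.Injective (fun i : Fin (p ^ n) => absRestrictNormalHom (κ.layer n) γ ^ (i : ℕ)) := fun i j hij =>
    Fin.ext (pow_injOn_Iio_orderOf (by rw [Set.mem_Iio, hord]; exact i.2) (by rw [Set.mem_Iio, hord]; exact j.2) hij)
  have hbij : Function.Bijective (fun i : Fin (p ^ n) => absRestrictNormalHom (κ.layer n) γ ^ (i : ℕ)) := by
    rw [Fintype.bijective_iff_injective_and_card]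
    exact ⟨hinj, by rw [Fintype.card_fin, ← Nat.card_eq_fintype_card, hcardG]⟩
  rw [← Fin.prod_univ_eq_prod_range
      (fun i => ClassGroup.mulEquiv (AmbiguousClass.intAut (absRestrictNormalHom (κ.layer n) γ ^ i)) y) (p ^ n),
    Fintype.prod_bijective _ hbij
      (fun i => ClassGroup.mulEquiv (AmbiguousClass.intAut (absRestrictNormalHom (κ.layer n) γ ^ (i : ℕ))) y)
      (fun τ => ClassGroup.mulEquiv (AmbiguousClass.intAut τ) y) (fun _ => rfl),
    ← classGroupExtend_classGroupNorm_eq_prod K (κ.layer n) y]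
  have hcop : Nat.Coprime (Fintype.card (ClassGroup (𝓞 K))) p :=
    (Nat.Prime.coprime_iff_not_dvd hp.out).mpr hK |>.symm
  obtain ⟨z, hz⟩ := exists_pow_eq_of_coprime_card hcop (classGroupNorm K (κ.layer n) y)
  exact ⟨classGroupExtend K (κ.layer n) z, by rw [powMonoidHom_apply, ← map_pow, hz]⟩

/-- ★ **The rank door, layer step.**  `κ` a `ℤ_p`-extension of `K` with `p ∤ h_K`; `K_{n+1}` a `K_n`-algebra compatibly with `K`; `N` onto;
`[Cl(K_{n+1}) : Cl^p·⟨τc/c : τ ∈ Gal(K_{n+1}/K_n)⟩] ≤ #(Cl(K_n)/Cl(K_n)^p)` ⟹ `rank_p Cl(K_{n+1}) = rank_p Cl(K_n)` (`D = E := N⁻¹(Cl(K_n)^p)` by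
counting; `ν·Cl ⊆ E`; `σ − 1 = (g−1)ν`; `g − 1` nilpotent on `Cl/Cl^p`; so `E = Cl^p`). [cite: Washington1997, §13.3 Lemmas 13.15–13.18, Prop. 13.22–13.23]
[cite: Fukuda1994, Thm. 1 (2), p. 264] -/
theorem classGroupPRank_layer_succ_eq_of_coinvariant_index_le [NumberField (κ.layer n)] [NumberField (κ.layer (n + 1))]
    (hK : ¬ p ∣ classNumber K) (hN : Function.Surjective (classGroupNorm (κ.layer n) (κ.layer (n + 1))))
    (hco : ((powMonoidHom p : ClassGroup (𝓞 (κ.layer (n + 1))) →* ClassGroup (𝓞 (κ.layer (n + 1)))).range ⊔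
        Subgroup.closure {x | ∃ (τ : (κ.layer (n + 1)) ≃ₐ[κ.layer n] (κ.layer (n + 1)))
          (c : ClassGroup (𝓞 (κ.layer (n + 1)))), x = ClassGroup.mulEquiv (AmbiguousClass.intAut τ) c * c⁻¹}).index ≤
      Nat.card (ClassGroup (𝓞 (κ.layer n)) ⧸
        (powMonoidHom p : ClassGroup (𝓞 (κ.layer n)) →* ClassGroup (𝓞 (κ.layer n))).range)) :
    classGroupPRank κ (n + 1) = classGroupPRank κ n := by
  classical
  haveI : FiniteDimensional K (κ.layer n) := κ.finiteDimensional_layer_holds n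
  haveI : FiniteDimensional K (κ.layer (n + 1)) := κ.finiteDimensional_layer_holds (n + 1)
  haveI : IsGalois K (κ.layer n) := κ.isGalois_layer_holds n
  haveI : IsGalois K (κ.layer (n + 1)) := κ.isGalois_layer_holds (n + 1)
  haveI : FiniteDimensional (κ.layer n) (κ.layer (n + 1)) := Module.Finite.of_restrictScalars_finite K _ _
  haveI : Normal K (κ.layer n) := IsGalois.to_normal
  haveI : Normal K (κ.layer (n + 1)) := IsGalois.to_normal
  haveI : IsGalois (κ.layer n) (κ.layer (n + 1)) := isGalois_layer_layer κ
  have hpr : p.Prime := hp.out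
  obtain ⟨γ, hγ⟩ : ∃ γ : absoluteGaloisGroup K, κ.IsTopGenerator γ := κ.surjective (Multiplicative.ofAdd 1)
  obtain ⟨σ, hσx, hσ⟩ := exists_aut_layer_layer_eq_topGenerator_pow κ hγ (Nat.le_succ n)
  set g : (κ.layer (n + 1)) ≃ₐ[K] (κ.layer (n + 1)) := absRestrictNormalHom (κ.layer (n + 1)) γ with hg
  set N := classGroupNorm (κ.layer n) (κ.layer (n + 1)) with hNdef
  have hσg : ∀ c : ClassGroup (𝓞 (κ.layer (n + 1))), ClassGroup.mulEquiv (AmbiguousClass.intAut σ) c =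
      ClassGroup.mulEquiv (AmbiguousClass.intAut (g ^ p ^ n)) c := fun c => by
    rw [hg, ← map_pow]; exact mulEquiv_intAut_eq_of_forall_coe_eq_smul κ hσx c
  have hgord : g ^ p ^ (n + 1) = 1 := by
    rw [hg, ← orderOf_absRestrictNormalHom_layer κ hγ (n + 1)]; exact pow_orderOf_eq_one _
  set G : MulAut (ClassGroup (𝓞 (κ.layer (n + 1)))) := ClassGroup.mulEquiv (AmbiguousClass.intAut g) with hGdef
  have hGpow : ∀ i : ℕ, (ClassGroup.mulEquiv (AmbiguousClass.intAut (g ^ i)) : MulAut (ClassGroup (𝓞 (κ.layer (n + 1))))) = G ^ i := by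
    intro i
    induction i with
    | zero => rw [pow_zero, pow_zero, AmbiguousClass.mulEquiv_intAut_one, MulAut.one_def]
    | succ i ih => rw [pow_succ', pow_succ', AmbiguousClass.mulEquiv_intAut_mul, ih, MulAut.mul_def]
  have hGord : ∀ a, (G ^ (p ^ (n + 1))) a = a := fun a => by
    rw [← hGpow, hgord, AmbiguousClass.mulEquiv_intAut_one, MulEquiv.refl_apply]
  let Nbar : ClassGroup (𝓞 (κ.layer (n + 1))) →* ClassGroup (𝓞 (κ.layer n)) ⧸
      (powMonoidHom p : ClassGroup (𝓞 (κ.layer n)) →* ClassGroup (𝓞 (κ.layer n))).range :=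
    (QuotientGroup.mk' _).comp N
  have hmemE : ∀ c, c ∈ Nbar.ker ↔
      N c ∈ (powMonoidHom p : ClassGroup (𝓞 (κ.layer n)) →* ClassGroup (𝓞 (κ.layer n))).range := fun c => by
    rw [MonoidHom.mem_ker, MonoidHom.comp_apply, QuotientGroup.mk'_apply, QuotientGroup.eq_one_iff]
  have hNbar_surj : Function.Surjective Nbar := (QuotientGroup.mk'_surjective _).comp hN
  have hEindex : Nbar.ker.index = Nat.card (ClassGroup (𝓞 (κ.layer n)) ⧸
      (powMonoidHom p : ClassGroup (𝓞 (κ.layer n)) →* ClassGroup (𝓞 (κ.layer n))).range) := by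
    rw [Subgroup.index_ker, MonoidHom.range_eq_top.mpr hNbar_surj, Subgroup.card_top]
  have hDE : (powMonoidHom p : ClassGroup (𝓞 (κ.layer (n + 1))) →* ClassGroup (𝓞 (κ.layer (n + 1)))).range ⊔
      Subgroup.closure {x | ∃ (τ : (κ.layer (n + 1)) ≃ₐ[κ.layer n] (κ.layer (n + 1)))
        (c : ClassGroup (𝓞 (κ.layer (n + 1)))), x = ClassGroup.mulEquiv (AmbiguousClass.intAut τ) c * c⁻¹} ≤ Nbar.ker := by
    refine sup_le ?_ ?_
    · rintro _ ⟨c, rfl⟩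
      rw [hmemE, powMonoidHom_apply, map_pow]
      exact MonoidHom.mem_range.mpr ⟨N c, rfl⟩
    · rw [Subgroup.closure_le]
      rintro _ ⟨τ, c, rfl⟩
      rw [SetLike.mem_coe, hmemE, map_mul, map_inv, hNdef, classGroupNorm_galois_smul, mul_inv_cancel]
      exact one_mem _
  have hDeqE : (powMonoidHom p : ClassGroup (𝓞 (κ.layer (n + 1))) →* ClassGroup (𝓞 (κ.layer (n + 1)))).range ⊔
      Subgroup.closure {x | ∃ (τ : (κ.layer (n + 1)) ≃ₐ[κ.layer n] (κ.layer (n + 1)))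
        (c : ClassGroup (𝓞 (κ.layer (n + 1)))), x = ClassGroup.mulEquiv (AmbiguousClass.intAut τ) c * c⁻¹} = Nbar.ker := by
    refine Subgroup.eq_of_le_of_card_ge hDE ?_
    have h1 := Subgroup.card_mul_index Nbar.ker
    rw [← Subgroup.card_mul_index ((powMonoidHom p : ClassGroup (𝓞 (κ.layer (n + 1))) →* _).range ⊔
      Subgroup.closure {x | ∃ (τ : (κ.layer (n + 1)) ≃ₐ[κ.layer n] (κ.layer (n + 1)))
        (c : ClassGroup (𝓞 (κ.layer (n + 1)))), x = ClassGroup.mulEquiv (AmbiguousClass.intAut τ) c * c⁻¹})] at h1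
    have h2 := hco
    rw [← hEindex] at h2
    refine Nat.le_of_mul_le_mul_right ?_ (Nat.pos_of_ne_zero (Subgroup.index_ne_zero_of_finite (H := Nbar.ker)))
    rw [h1]
    exact Nat.mul_le_mul_left _ h2
  have hνE : ∀ c : ClassGroup (𝓞 (κ.layer (n + 1))),
      (∏ i ∈ range (p ^ n), ClassGroup.mulEquiv (AmbiguousClass.intAut (g ^ i)) c) ∈ Nbar.ker := fun c => by
    rw [hmemE, hNdef, hg]
    exact classGroupNorm_prod_galois_pow_smul_mem_range_powMonoidHom κ n hK hγ c
  have htel : ∀ c : ClassGroup (𝓞 (κ.layer (n + 1))),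
      ClassGroup.mulEquiv (AmbiguousClass.intAut σ) c * c⁻¹ =
        G (∏ i ∈ range (p ^ n), ClassGroup.mulEquiv (AmbiguousClass.intAut (g ^ i)) c) *
          (∏ i ∈ range (p ^ n), ClassGroup.mulEquiv (AmbiguousClass.intAut (g ^ i)) c)⁻¹ := by
    intro c
    rw [hσg, hGdef, map_prod]
    have hstep : ∀ i : ℕ, ClassGroup.mulEquiv (AmbiguousClass.intAut g)
        (ClassGroup.mulEquiv (AmbiguousClass.intAut (g ^ i)) c) =
        ClassGroup.mulEquiv (AmbiguousClass.intAut (g ^ (i + 1))) c := fun i => by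
      rw [pow_succ', AmbiguousClass.mulEquiv_intAut_mul, MulEquiv.trans_apply]
    simp_rw [hstep]
    have tel : (∏ i ∈ range (p ^ n), ClassGroup.mulEquiv (AmbiguousClass.intAut (g ^ (i + 1))) c) *
        (∏ i ∈ range (p ^ n), ClassGroup.mulEquiv (AmbiguousClass.intAut (g ^ i)) c)⁻¹ =
        ClassGroup.mulEquiv (AmbiguousClass.intAut (g ^ p ^ n)) c *
          (ClassGroup.mulEquiv (AmbiguousClass.intAut (g ^ 0)) c)⁻¹ := by
      rw [← div_eq_mul_inv, ← div_eq_mul_inv, ← prod_div_distrib]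
      exact prod_range_div (fun i => ClassGroup.mulEquiv (AmbiguousClass.intAut (g ^ i)) c) (p ^ n)
    rw [tel, pow_zero, AmbiguousClass.mulEquiv_intAut_one, MulEquiv.refl_apply]
  have hdiv : ∀ e ∈ Nbar.ker, ∃ e' ∈ Nbar.ker,
      ∃ q ∈ (powMonoidHom p : ClassGroup (𝓞 (κ.layer (n + 1))) →* ClassGroup (𝓞 (κ.layer (n + 1)))).range,
        e = G e' * e'⁻¹ * q := by
    let Tm : ClassGroup (𝓞 (κ.layer (n + 1))) →* ClassGroup (𝓞 (κ.layer (n + 1))) :=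
      { toFun := fun c => G c * c⁻¹
        map_one' := by rw [map_one, inv_one, mul_one]
        map_mul' := fun a b => by rw [map_mul, mul_inv, mul_mul_mul_comm] }
    have hTm : ∀ c, Tm c = G c * c⁻¹ := fun _ => rfl
    set H := Nbar.ker.map Tm ⊔
      (powMonoidHom p : ClassGroup (𝓞 (κ.layer (n + 1))) →* ClassGroup (𝓞 (κ.layer (n + 1)))).range with hH
    have hHmem : ∀ e, e ∈ H → ∃ e' ∈ Nbar.ker,
        ∃ q ∈ (powMonoidHom p : ClassGroup (𝓞 (κ.layer (n + 1))) →* ClassGroup (𝓞 (κ.layer (n + 1)))).range,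
          e = G e' * e'⁻¹ * q := by
      intro e he
      obtain ⟨y, hy, q, hq, rfl⟩ := Subgroup.mem_sup.mp he
      obtain ⟨e', he', rfl⟩ := hy
      exact ⟨e', he', q, hq, by rw [hTm]⟩
    have hDH : Nbar.ker ≤ H := by
      rw [← hDeqE]
      refine sup_le le_sup_right ?_
      rw [Subgroup.closure_le]
      rintro _ ⟨τ, c, rfl⟩
      rw [SetLike.mem_coe]
      obtain ⟨k, rfl⟩ := Herbrand.exists_pow_eq_of_forall_mem_zpowers (fun τ' => by rw [hσ]; exact Subgroup.mem_top τ') τ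
      induction k with
      | zero =>
        rw [pow_zero, AmbiguousClass.mulEquiv_intAut_one, MulEquiv.refl_apply, mul_inv_cancel]
        exact one_mem _
      | succ k ih =>
        have hsplit : ClassGroup.mulEquiv (AmbiguousClass.intAut (σ ^ (k + 1))) c * c⁻¹ =
            (ClassGroup.mulEquiv (AmbiguousClass.intAut σ) (ClassGroup.mulEquiv (AmbiguousClass.intAut (σ ^ k)) c) *
              (ClassGroup.mulEquiv (AmbiguousClass.intAut (σ ^ k)) c)⁻¹) *
            (ClassGroup.mulEquiv (AmbiguousClass.intAut (σ ^ k)) c * c⁻¹) := by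
          rw [pow_succ', AmbiguousClass.mulEquiv_intAut_mul, MulEquiv.trans_apply, mul_assoc, inv_mul_cancel_left]
        rw [hsplit]
        refine mul_mem ?_ ih
        rw [htel, ← hTm]
        exact Subgroup.mem_sup_left (Subgroup.mem_map_of_mem _ (hνE _))
    exact fun e he => hHmem e (hDH he)
  have hEPL := eq_range_powMonoidHom_of_divisible (n + 1) G hGord Nbar.ker (le_sup_left.trans hDE) hdiv
  rw [classGroupPRank_def, classGroupPRank_def, ← hEPL]
  exact congrArg _ (Nat.card_congr (QuotientGroup.quotientKerEquivOfSurjective Nbar hNbar_surj).toEquiv)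

/-- The same door with the bound written `p ^ rank_p Cl(K_n)` (`#(Cl(K_n)/Cl(K_n)^p) = p^{rank_p Cl(K_n)}`).
[cite: Fukuda1994, p. 264 (definition of `rank`)] [cite: Washington1997, §13.3 Prop. 13.22–13.23] -/
theorem classGroupPRank_layer_succ_eq_of_coinvariant_index_le_pow [NumberField (κ.layer n)] [NumberField (κ.layer (n + 1))]
    (hK : ¬ p ∣ classNumber K) (hN : Function.Surjective (classGroupNorm (κ.layer n) (κ.layer (n + 1))))
    (hco : ((powMonoidHom p : ClassGroup (𝓞 (κ.layer (n + 1))) →* ClassGroup (𝓞 (κ.layer (n + 1)))).range ⊔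
        Subgroup.closure {x | ∃ (τ : (κ.layer (n + 1)) ≃ₐ[κ.layer n] (κ.layer (n + 1)))
          (c : ClassGroup (𝓞 (κ.layer (n + 1)))), x = ClassGroup.mulEquiv (AmbiguousClass.intAut τ) c * c⁻¹}).index ≤
      p ^ classGroupPRank κ n) :
    classGroupPRank κ (n + 1) = classGroupPRank κ n := by
  refine classGroupPRank_layer_succ_eq_of_coinvariant_index_le κ n hK hN (hco.trans_eq ?_)
  rw [classGroupPRank_def]
  exact (card_eq_pow_padicValNat_of_pow_eq_one (p := p) fun q => by
    induction q using QuotientGroup.induction_on with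
    | H c => exact (QuotientGroup.eq_one_iff (c ^ p)).mpr (MonoidHom.mem_range.mpr ⟨c, rfl⟩)).symm

end Layer

/-! ## §2 The tower -/

section Tower

variable {K : Type} [Field K] [NumberField K] {p : ℕ} [hp : Fact p.Prime] (κ : ZpExtension K p)

/-- ★ **The rank door along the tower.**  `p ∤ h_K`, Fukuda's index `n₀ ≤ n`, `[Cl(K_{n+1}) : Cl^p·⟨τc/c⟩] ≤ p^{rank_p Cl(K_n)}` ⟹
`rank_p Cl(K_m) = rank_p Cl(K_n)` for all `m ≥ n`, `μ = 0` (growth form), `λ ≤ rank_p Cl(K_n)` (norm onto by `classGroupNorm_layer_succ_surjective`,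
the layer step, Fukuda's Thm. 1 (2), `classicalLambda_le_of_forall_classGroupPRank_le`). [cite: Fukuda1994, Thm. 1 (2), p. 264]
[cite: Washington1997, §13.3 Prop. 13.22–13.23] -/
theorem classGroupPRank_const_and_classicalMuVanishes_of_coinvariant_index_le {n₀ : ℕ} (hram : TotallyRamifiedFrom κ n₀)
    (hK : ¬ p ∣ classNumber K) (n : ℕ) (hn : n₀ ≤ n) [NumberField (κ.layer n)] [NumberField (κ.layer (n + 1))]
    [Algebra (κ.layer n) (κ.layer (n + 1))] [IsScalarTower K (κ.layer n) (κ.layer (n + 1))]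
    (hco : ((powMonoidHom p : ClassGroup (𝓞 (κ.layer (n + 1))) →* ClassGroup (𝓞 (κ.layer (n + 1)))).range ⊔
        Subgroup.closure {x | ∃ (τ : (κ.layer (n + 1)) ≃ₐ[κ.layer n] (κ.layer (n + 1)))
          (c : ClassGroup (𝓞 (κ.layer (n + 1)))), x = ClassGroup.mulEquiv (AmbiguousClass.intAut τ) c * c⁻¹}).index ≤
      p ^ classGroupPRank κ n) :
    (∀ m, n ≤ m → classGroupPRank κ m = classGroupPRank κ n) ∧ ClassicalMuVanishes κ ∧
      classicalLambda κ ≤ classGroupPRank κ n := by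
  have hstep := classGroupPRank_layer_succ_eq_of_coinvariant_index_le_pow κ n hK
    (classGroupNorm_layer_succ_surjective κ n hram hn) hco
  obtain ⟨hconst, hμ⟩ := fukuda1994_thm1_classGroupPRank_const_of_succ_eq_holds K p κ n₀ hram n hn hstep
  exact ⟨hconst, hμ, (classicalLambda_le_of_forall_classGroupPRank_le κ hram hn (B := classGroupPRank κ n)
    fun m hm => (hconst m hm).le).2⟩

end Tower

end Literature.NumberTheory.IwasawaTheory

end
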